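import Summits.CriticalPhenomena.PercolationContinuityZ3.Theorems.PercNearOneGluingNoHeavyLowerTailSwitchRelaxFinc41
import HarnessLib

/-!
# Finite-relaxation replay of the clean switching certificate `Finc41`: kernel checks at input types 5–9

Support file (prover prim-masterthm-p1 gen 2; `--supports stmt-CriticalPhenomena-4575`).  No named facts, no sorries.  Split from
`…SwitchRelaxFinc41` only to keep each file's kernel time small.
-/

namespace Summit.CriticalPhenomena.PercolationContinuityZ3.Theorems

namespace SwitchRelax

namespace Finc41

/-- Kernel evaluation of the finite relaxation at input type `5`. [this work] -/
theorem checkAt_5 : certFinc41.checkAt 5 = true := by decide +kernel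

/-- Kernel evaluation of the finite relaxation at input type `6`. [this work] -/
theorem checkAt_6 : certFinc41.checkAt 6 = true := by decide +kernel

/-- Kernel evaluation of the finite relaxation at input type `7`. [this work] -/
theorem checkAt_7 : certFinc41.checkAt 7 = true := by decide +kernel

/-- Kernel evaluation of the finite relaxation at input type `8`. [this work] -/
theorem checkAt_8 : certFinc41.checkAt 8 = true := by decide +kernel

/-- Kernel evaluation of the finite relaxation at input type `9`. [this work] -/
theorem checkAt_9 : certFinc41.checkAt 9 = true := by decide +kernel

end Finc41

end SwitchRelax

end Summit.CriticalPhenomena.PercolationContinuityZ3.Theorems
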